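import Summits.QuantumFields.YangMills.Theorems.BalabanUVNodesN11SpaceTruncationCharged
import Summits.QuantumFields.YangMills.Theorems.BalabanUVNodesN11TkIteratedFibreReadingSlot

/-!
# DAG node N11 — door (d4) ON THE ITERATED AVERAGING FIBRE: the space-truncated witness has the §2 slot of the witness for a.e. top-scale field as soon as the background
# proviso holds on the ITERATED FIBRE of the reading support (trivial off the V-bonds, `avg(𝐖_j) = 𝐖_{j+1}` on `bondsIn (j+1) (Ω_{j+1})ᶜ`) — the transport lemmas re-keyed

HEADER — WORK-UNIT METADATA.  Cell `pub-ymgap`, YM-PLAN Track A (HUMAN RULING D-0062), seat `pub-ymgap-dag-n11-d` (g13; R134 fan-out seat N11 [B14], strategy s2),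
route `BalabanUVNodes`, item K1⁷ `StabilityBAtRecordR13SepCoPH` = stmt-QuantumFields-20542 (helper, `--kind proof --supports 20542 --as helper`, count-neutral).
[III] = [Balaban1988Convergent].  Over this seat's p589738 `…N11SpaceTruncation` (`action23_spaceTrunc_eq_of_mem`, `sect2Slot_spaceTrunc_eq`), p591695
`…N11SpaceTruncationBorelB` (`action23_spaceTruncR_eq_of_mem`), p594941 `…N11SpaceTruncationCharged` (`hasSect2FormAtZS_spaceTrunc(R)_of_charged`), and g13's
`…N11TkIteratedFibreReadingSlot` (★★★ `sect2Slot_congr_on_fibre_ae`: the §2 slot reads its operand only on the iterated averaging fibre, `fieldMeasure`-a.e. in `V_n`).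

WHY THIS FILE.  p589738∕p591695∕p594941 key def-R's background proviso (`BgProvisoΛ`'s body) over p589098's POINTWISE reading support `{𝐖 | 𝐖 n = V_n, scales j < n regular}`.
`HasSect2FormAtZS`'s identity clause is an a.e. statement in `V_n`; 11a's `𝐓_n(s)` reads its operand, for a.e. `V_n`, only on the ITERATED AVERAGING FIBRE (scales `j < n`
trivial off `bondsIn j (Ω_{j+1})ᶜ` and satisfying `(avOfRecord j).avg (𝐖 j) = 𝐖 (j+1)` on `bondsIn (j+1) (Ω_{j+1})ᶜ`).  So the proviso is needed on that fibre only — where the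
junction's (7)-data half is a theorem (`…N11Data7OnFibre`).  This file re-keys the four transport lemmas accordingly; the record faces follow in `…N11SpaceTruncationChargedFibre`.

WHAT THIS FILE PROVES (0 `sorry`, 0 `def`).
* ★★ `sect2Slot_spaceTrunc_ae_eq_fibre` ∕ `sect2Slot_spaceTruncR_ae_eq_fibre` — for `fieldMeasure`-a.e. `V_n`: if the background `U(𝐖)` lies in the spaces of record on print's
  ranges at every `𝐖` of the ITERATED FIBRE over `V_n`, the §2 slot of the (retracted) space-truncated family at `V_n` is the slot (p589738's `sect2Slot_spaceTrunc_eq` a.e., two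
  hypotheses on `𝐖` added).
* ★★ `hasSect2FormAtZS_spaceTrunc_of_charged_fibre` ∕ `hasSect2FormAtZS_spaceTruncR_of_charged_fibre` — p594941's charged transports with the background hypothesis demanded
  on the iterated fibre only.

HONEST FRAMING.  Helper lane of K1⁷; bookkeeping over tree theorems; nothing of Bałaban's is asserted.  N11 NOT discharged; K1⁷ NOT closed; counts unmoved (typed 28∕28 ·
discharged 5∕27).  One finite four-torus programme at fixed `ε = L^{−K}` — NOT ℝ⁴, NOT OS, NOT a mass gap, NOT Clay.  No `sorry`, `axiom`, `def`, `instance`, `notation`.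
Sources (SHAPE only): [III] (2.10) p.256, (2.17)–(2.18) p.257, (2.20)–(2.23) p.258, (2.26)–(2.28) p.259, (2.30)–(2.31) p.260, (2.41)–(2.42) p.261, Thm 1 p.262, (1.4) p.246.
-/

noncomputable section

open MeasureTheory
open scoped BigOperators ENNReal NNReal Matrix.Norms.L2Operator

universe u

namespace Summit.QuantumFields.YangMills.Theorems.BalabanUVNodesN11SpaceTruncationFibre

open Literature.MathematicalPhysics.QuantumFieldTheory.Balaban1983to89 T4Continuum T4NestedCovariance Node00 Node00.Tk DagBinding
open B15DeterminingSets B8Eq17ClassAkV1 Step B14.Eq227LocalizedTerms B14.Eq225Concrete B10Eq42TorusConstraint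
open BalabanUVNodesN11OpenLocusTruncationDefs BalabanUVNodesN11SpaceTruncationDefs BalabanUVNodesN11SpaceTruncationBorelBDefs
open BalabanUVNodesN11SpaceTruncation (action23_spaceTrunc_eq_of_mem)
open BalabanUVNodesN11SpaceTruncationBorelB (action23_spaceTruncR_eq_of_mem)
open BalabanUVNodesN11TkIteratedFibreReadingSlot (sect2Slot_congr_on_fibre_ae)

section Slot

variable {F : T4Family} {N : ℕ} [NeZero N] {V : Type} [NormedAddCommGroup V] [InnerProductSpace ℝ V] [FiniteDimensional ℝ V] [MeasurableSpace V] [BorelSpace V]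
variable {𝔸 : Type*} [NormedRing 𝔸] [NormedAlgebra ℂ 𝔸] [CompleteSpace 𝔸]
variable {ν : Stage7Numerics} {M : ℕ} {g : ℕ → ℝ} {K : ℕ}

/-- **★★ THE §2 SLOT OF THE SPACE-TRUNCATED FAMILY IS THE SLOT, a.e. IN `V_n`, GIVEN THE BACKGROUND PROVISO ON THE ITERATED FIBRE ONLY**: for
`fieldMeasure`-a.e. `V_n`, if at every `𝐖` with `𝐖 n = V_n`, `Reg j (𝐖 j)`, `𝐖 j ≡ 1` off `bondsIn j (Ω_{j+1})ᶜ` and `(avOfRecord j).avg (𝐖 j) = 𝐖 (j+1)` on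
`bondsIn (j+1) (Ω_{j+1})ᶜ` (`j < n`) the background `U(𝐖)` lies in the spaces of record on print's ranges, then the slot of `spaceTrunc Sg n₀ t` at `V_n` is the slot of `t`
(laws at `n ≤ n₀`, couplings in `[0, γ]`, vacuum in every `U^c_j(X)` as before). [cite: Balaban1988Convergent, (2.18) p.257, (2.20)–(2.23) p.258, (2.26)–(2.28) p.259, (2.30)–(2.31) p.260, (2.41)–(2.42) p.261, (2.10) p.256, (1.4) p.246] -/
theorem sect2Slot_spaceTrunc_ae_eq_fibre (Sg : Sect2.Setting 𝔸 (SU N)) (Rz : Sect2.Residual (F.P K) 𝔸) (W : TkWeights F N V K) {n n₀ : ℕ} (hn : n ≤ n₀)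
    (s : SeqOfRecord F ν M g K n) (Reg : (j : ℕ) → GaugeField (F.P K) j (SU N) → Prop)
    (hζ : ∀ j, j < n → ∀ ω : MultiCfg (F.P K) (SU N) V, W.ζ j (s.Ω (j + 1))ᶜ ω ≠ 0 → Reg j (ω j).1)
    (t : Sect2.TermValues (F.P K) 𝔸 V M) (Ek : ℝ) (U : BgMap F N K)
    (hlaw : Sect2.LawsRT (sect2TowerOfRecord F N V K Sg Rz s t) Sg.lf n)
    (hg : ∀ j, 1 ≤ j → j ≤ n → 0 ≤ Sg.flow.g (j - 1) ∧ Sg.flow.g (j - 1) ≤ Sg.lf.γ)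
    (h1 : ∀ j, 1 ≤ j → j ≤ n → ∀ X : (Sect2.domSys (F.P K) M j).Dom,
      Sect2.ofBackgroundC Sg.ι (1 : GaugeField (F.P K) 0 (SU N)) ∈
        Sect2.spaceI Sg Rz M j (Sect2.domSites (F.P K) M j X) (Sg.lf.alpha0 (Sg.flow.g j)) (Sg.lf.alpha1 (Sg.flow.g j))) :
    ∀ᵐ Vn ∂fieldMeasure (F.P K) n (SU N),
      (∀ Wc : MSField (F.P K) (SU N), Wc n = Vn → (∀ j, j < n → Reg j (Wc j)) →
        (∀ j, j < n → ∀ b : PBond (F.P K) j, b ∉ bondsIn j (s.Ω (j + 1))ᶜ → Wc j b = 1) →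
        (∀ j, j < n → ∀ b : PBond (F.P K) (j + 1), b ∈ bondsIn (j + 1) (s.Ω (j + 1))ᶜ → (avOfRecord F N K j).avg (Wc j) b = Wc (j + 1) b) →
        ∀ j, 1 ≤ j → j ≤ n → ∀ X : (Sect2.domSys (F.P K) M j).Dom,
        (Sect2.domSites (F.P K) M j X ⊆ s.Λ j →
          Sect2.ofBackgroundC Sg.ι (U Wc) ∈ Sect2.spaceI Sg Rz M j (Sect2.domSites (F.P K) M j X) (Sg.lf.alpha0 (Sg.flow.g j)) (Sg.lf.alpha1 (Sg.flow.g j))) ∧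
        (Sect2.admB (F.P K) ν M g s.Ω s.Λ j (Sect2.domSites (F.P K) M j X) = true →
          Sect2.ofBackgroundC Sg.ι (U Wc) ∈ Sect2.spaceMS Sg Rz M j (Sect2.domSites (F.P K) M j X) s.Ω)) →
      sect2Slot F N V K Sg Rz W s (spaceTrunc Sg n₀ t) Ek U Vn = sect2Slot F N V K Sg Rz W s t Ek U Vn := by
  filter_upwards [sect2Slot_congr_on_fibre_ae ν M g K W Sg Rz s Reg hζ] with Vn hVn hbg
  exact hVn _ _ Ek Ek U U fun a Wc hW hR hoff hfib => by
    show Real.exp ((Sect2.actionDataOfTerms Sg Rz ν M g s.Ω s.Λ (spaceTrunc Sg n₀ t) n a Ek).action23 n (U Wc)) =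
      Real.exp ((Sect2.actionDataOfTerms Sg Rz ν M g s.Ω s.Λ t n a Ek).action23 n (U Wc))
    rw [action23_spaceTrunc_eq_of_mem Sg Rz ν g s.Ω s.Λ t hn a Ek (U Wc) hlaw hg h1 (fun j h1j hjn X hX => (hbg Wc hW hR hoff hfib j h1j hjn X).1 hX)
      (fun j h1j hjn X hadm => (hbg Wc hW hR hoff hfib j h1j hjn X).2 hadm)]

/-- **★★ THE §2 SLOT OF THE RETRACTED SPACE-TRUNCATED FAMILY IS THE SLOT, a.e. IN `V_n`, GIVEN THE BACKGROUND PROVISO ON THE ITERATED FIBRE ONLY**: for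
`fieldMeasure`-a.e. `V_n`, if at every `𝐖` with `𝐖 n = V_n`, `Reg j (𝐖 j)`, `𝐖 j ≡ 1` off `bondsIn j (Ω_{j+1})ᶜ` and `(avOfRecord j).avg (𝐖 j) = 𝐖 (j+1)` on
`bondsIn (j+1) (Ω_{j+1})ᶜ` (`j < n`) the background `U(𝐖)` lies in the spaces of record on print's ranges, then the slot of `spaceTruncR Sg n₀ t` at `V_n` is the slot of `t`
(laws at `n ≤ n₀`, couplings in `[0, γ]`, vacuum in every `U^c_j(X)` as before). [cite: Balaban1988Convergent, (2.18) p.257, (2.20)–(2.23) p.258, (2.26)–(2.28) p.259, (2.30)–(2.31) p.260, (2.41)–(2.42) p.261, (2.10) p.256, (1.4) p.246] -/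
theorem sect2Slot_spaceTruncR_ae_eq_fibre (Sg : Sect2.Setting 𝔸 (SU N)) (Rz : Sect2.Residual (F.P K) 𝔸) (W : TkWeights F N V K) {n n₀ : ℕ} (hn : n ≤ n₀)
    (s : SeqOfRecord F ν M g K n) (Reg : (j : ℕ) → GaugeField (F.P K) j (SU N) → Prop)
    (hζ : ∀ j, j < n → ∀ ω : MultiCfg (F.P K) (SU N) V, W.ζ j (s.Ω (j + 1))ᶜ ω ≠ 0 → Reg j (ω j).1)
    (t : Sect2.TermValues (F.P K) 𝔸 V M) (Ek : ℝ) (U : BgMap F N K)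
    (hlaw : Sect2.LawsRT (sect2TowerOfRecord F N V K Sg Rz s t) Sg.lf n)
    (hg : ∀ j, 1 ≤ j → j ≤ n → 0 ≤ Sg.flow.g (j - 1) ∧ Sg.flow.g (j - 1) ≤ Sg.lf.γ)
    (h1 : ∀ j, 1 ≤ j → j ≤ n → ∀ X : (Sect2.domSys (F.P K) M j).Dom,
      Sect2.ofBackgroundC Sg.ι (1 : GaugeField (F.P K) 0 (SU N)) ∈
        Sect2.spaceI Sg Rz M j (Sect2.domSites (F.P K) M j X) (Sg.lf.alpha0 (Sg.flow.g j)) (Sg.lf.alpha1 (Sg.flow.g j))) :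
    ∀ᵐ Vn ∂fieldMeasure (F.P K) n (SU N),
      (∀ Wc : MSField (F.P K) (SU N), Wc n = Vn → (∀ j, j < n → Reg j (Wc j)) →
        (∀ j, j < n → ∀ b : PBond (F.P K) j, b ∉ bondsIn j (s.Ω (j + 1))ᶜ → Wc j b = 1) →
        (∀ j, j < n → ∀ b : PBond (F.P K) (j + 1), b ∈ bondsIn (j + 1) (s.Ω (j + 1))ᶜ → (avOfRecord F N K j).avg (Wc j) b = Wc (j + 1) b) →
        ∀ j, 1 ≤ j → j ≤ n → ∀ X : (Sect2.domSys (F.P K) M j).Dom,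
        (Sect2.domSites (F.P K) M j X ⊆ s.Λ j →
          Sect2.ofBackgroundC Sg.ι (U Wc) ∈ Sect2.spaceI Sg Rz M j (Sect2.domSites (F.P K) M j X) (Sg.lf.alpha0 (Sg.flow.g j)) (Sg.lf.alpha1 (Sg.flow.g j))) ∧
        (Sect2.admB (F.P K) ν M g s.Ω s.Λ j (Sect2.domSites (F.P K) M j X) = true →
          Sect2.ofBackgroundC Sg.ι (U Wc) ∈ Sect2.spaceMS Sg Rz M j (Sect2.domSites (F.P K) M j X) s.Ω)) →
      sect2Slot F N V K Sg Rz W s (spaceTruncR Sg n₀ t) Ek U Vn = sect2Slot F N V K Sg Rz W s t Ek U Vn := by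
  filter_upwards [sect2Slot_congr_on_fibre_ae ν M g K W Sg Rz s Reg hζ] with Vn hVn hbg
  exact hVn _ _ Ek Ek U U fun a Wc hW hR hoff hfib => by
    show Real.exp ((Sect2.actionDataOfTerms Sg Rz ν M g s.Ω s.Λ (spaceTruncR Sg n₀ t) n a Ek).action23 n (U Wc)) =
      Real.exp ((Sect2.actionDataOfTerms Sg Rz ν M g s.Ω s.Λ t n a Ek).action23 n (U Wc))
    rw [action23_spaceTruncR_eq_of_mem Sg Rz ν g s.Ω s.Λ t hn a Ek (U Wc) hlaw hg h1 (fun j h1j hjn X hX => (hbg Wc hW hR hoff hfib j h1j hjn X).1 hX)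
      (fun j h1j hjn X hadm => (hbg Wc hW hR hoff hfib j h1j hjn X).2 hadm)]

/-- **★★ THE §2 FORM PREDICATE TRANSPORTS TO THE SPACE-TRUNCATED WITNESS FAMILY, the background hypothesis read ONLY AT CHARGED INDICES AND ONLY ON THE ITERATED FIBRE** (`slot s₀ ≠ 0`): at an
uncharged index the per-index clause `slot s₀ = 0 ∨ …` holds by its zero branch; at a charged one the identity clause is a.e. in `V_k` and `sect2Slot_spaceTrunc_ae_eq_fibre` applies.
[cite: Balaban1988Convergent, (2.17)–(2.18) p.257, Thm 1 p.262, (2.28) p.259, (2.10) p.256] -/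
theorem hasSect2FormAtZS_spaceTrunc_of_charged_fibre (Sg : Sect2.Setting 𝔸 (SU N)) {k n₀ : ℕ} (hk : k ≤ n₀) (Rz : SeqOfRecord F ν M g K k → Sect2.Residual (F.P K) 𝔸)
    (W : SeqOfRecord F ν M g K k → TkWeights F N V K) (U : SeqOfRecord F ν M g K k → BgMap F N K)
    (slot : SeqOfRecord F ν M g K k → Density (F.P K) k (SU N))
    (Reg : SeqOfRecord F ν M g K k → (j : ℕ) → GaugeField (F.P K) j (SU N) → Prop)
    (hζ : ∀ s₀ j, j < k → ∀ ω : MultiCfg (F.P K) (SU N) V, (W s₀).ζ j (s₀.Ω (j + 1))ᶜ ω ≠ 0 → Reg s₀ j (ω j).1)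
    (hg : ∀ j, 1 ≤ j → j ≤ k → 0 ≤ Sg.flow.g (j - 1) ∧ Sg.flow.g (j - 1) ≤ Sg.lf.γ)
    (h1 : ∀ s₀ j, 1 ≤ j → j ≤ k → ∀ X : (Sect2.domSys (F.P K) M j).Dom,
      Sect2.ofBackgroundC Sg.ι (1 : GaugeField (F.P K) 0 (SU N)) ∈
        Sect2.spaceI Sg (Rz s₀) M j (Sect2.domSites (F.P K) M j X) (Sg.lf.alpha0 (Sg.flow.g j)) (Sg.lf.alpha1 (Sg.flow.g j)))
    (hbg : ∀ s₀, slot s₀ ≠ 0 → ∀ Wc : MSField (F.P K) (SU N), chiSeqOfRecord F N ν M g K k s₀ (Wc k) ≠ 0 → (∀ j, j < k → Reg s₀ j (Wc j)) →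
      (∀ j, j < k → ∀ b : PBond (F.P K) j, b ∉ bondsIn j (s₀.Ω (j + 1))ᶜ → Wc j b = 1) →
      (∀ j, j < k → ∀ b : PBond (F.P K) (j + 1), b ∈ bondsIn (j + 1) (s₀.Ω (j + 1))ᶜ → (avOfRecord F N K j).avg (Wc j) b = Wc (j + 1) b) →
      ∀ j, 1 ≤ j → j ≤ k → ∀ X : (Sect2.domSys (F.P K) M j).Dom,
      (Sect2.domSites (F.P K) M j X ⊆ s₀.Λ j →
        Sect2.ofBackgroundC Sg.ι (U s₀ Wc) ∈ Sect2.spaceI Sg (Rz s₀) M j (Sect2.domSites (F.P K) M j X) (Sg.lf.alpha0 (Sg.flow.g j)) (Sg.lf.alpha1 (Sg.flow.g j))) ∧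
      (Sect2.admB (F.P K) ν M g s₀.Ω s₀.Λ j (Sect2.domSites (F.P K) M j X) = true →
        Sect2.ofBackgroundC Sg.ι (U s₀ Wc) ∈ Sect2.spaceMS Sg (Rz s₀) M j (Sect2.domSites (F.P K) M j X) s₀.Ω))
    {t : SeqOfRecord F ν M g K k → Sect2.TermValues (F.P K) 𝔸 V M} {Ek : SeqOfRecord F ν M g K k → ℝ}
    (h : HasSect2FormAtZS F N V K Sg k Rz W U (fun s₀ t₀ => Sect2.LawsRT (sect2TowerOfRecord F N V K Sg (Rz s₀) s₀ t₀) Sg.lf k) slot t Ek) :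
    HasSect2FormAtZS F N V K Sg k Rz W U (fun s₀ t₀ => Sect2.LawsRT (sect2TowerOfRecord F N V K Sg (Rz s₀) s₀ t₀) Sg.lf k) slot
      (fun s₀ => spaceTrunc Sg n₀ (t s₀)) Ek := by
  refine ⟨universalE_spaceTrunc h.1 Sg n₀, fun s₀ => ⟨lawsRT_spaceTrunc Sg (Rz s₀) s₀.Ω (t s₀) hk (h.2 s₀).1, ?_⟩⟩
  by_cases hs : slot s₀ = 0
  · exact Or.inl hs
  rcases (h.2 s₀).2 with h0 | hae
  · exact Or.inl h0
  · refine Or.inr ?_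
    filter_upwards [hae, sect2Slot_spaceTrunc_ae_eq_fibre Sg (Rz s₀) (W s₀) hk s₀ (Reg s₀) (hζ s₀) (t s₀) (Ek s₀) (U s₀) (h.2 s₀).1 hg (h1 s₀)]
      with Vn hVn hfibre hχ
    rw [hVn hχ]
    exact (hfibre fun Wc hW hR hoff hfb => hbg s₀ hs Wc (by rw [hW]; exact hχ) hR hoff hfb).symm

/-- **★★ The same for the RETRACTED family `spaceTruncR`** (p594941's `hasSect2FormAtZS_spaceTruncR_of_charged`, background read only at charged indices and only on the iterated fibre).
[cite: Balaban1988Convergent, (2.17)–(2.18) p.257, Thm 1 p.262, (2.28) p.259, (2.10) p.256] -/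
theorem hasSect2FormAtZS_spaceTruncR_of_charged_fibre (Sg : Sect2.Setting 𝔸 (SU N)) {k n₀ : ℕ} (hk : k ≤ n₀) (Rz : SeqOfRecord F ν M g K k → Sect2.Residual (F.P K) 𝔸)
    (W : SeqOfRecord F ν M g K k → TkWeights F N V K) (U : SeqOfRecord F ν M g K k → BgMap F N K)
    (slot : SeqOfRecord F ν M g K k → Density (F.P K) k (SU N))
    (Reg : SeqOfRecord F ν M g K k → (j : ℕ) → GaugeField (F.P K) j (SU N) → Prop)
    (hζ : ∀ s₀ j, j < k → ∀ ω : MultiCfg (F.P K) (SU N) V, (W s₀).ζ j (s₀.Ω (j + 1))ᶜ ω ≠ 0 → Reg s₀ j (ω j).1)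
    (hg : ∀ j, 1 ≤ j → j ≤ k → 0 ≤ Sg.flow.g (j - 1) ∧ Sg.flow.g (j - 1) ≤ Sg.lf.γ)
    (h1 : ∀ s₀ j, 1 ≤ j → j ≤ k → ∀ X : (Sect2.domSys (F.P K) M j).Dom,
      Sect2.ofBackgroundC Sg.ι (1 : GaugeField (F.P K) 0 (SU N)) ∈
        Sect2.spaceI Sg (Rz s₀) M j (Sect2.domSites (F.P K) M j X) (Sg.lf.alpha0 (Sg.flow.g j)) (Sg.lf.alpha1 (Sg.flow.g j)))
    (hbg : ∀ s₀, slot s₀ ≠ 0 → ∀ Wc : MSField (F.P K) (SU N), chiSeqOfRecord F N ν M g K k s₀ (Wc k) ≠ 0 → (∀ j, j < k → Reg s₀ j (Wc j)) →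
      (∀ j, j < k → ∀ b : PBond (F.P K) j, b ∉ bondsIn j (s₀.Ω (j + 1))ᶜ → Wc j b = 1) →
      (∀ j, j < k → ∀ b : PBond (F.P K) (j + 1), b ∈ bondsIn (j + 1) (s₀.Ω (j + 1))ᶜ → (avOfRecord F N K j).avg (Wc j) b = Wc (j + 1) b) →
      ∀ j, 1 ≤ j → j ≤ k → ∀ X : (Sect2.domSys (F.P K) M j).Dom,
      (Sect2.domSites (F.P K) M j X ⊆ s₀.Λ j →
        Sect2.ofBackgroundC Sg.ι (U s₀ Wc) ∈ Sect2.spaceI Sg (Rz s₀) M j (Sect2.domSites (F.P K) M j X) (Sg.lf.alpha0 (Sg.flow.g j)) (Sg.lf.alpha1 (Sg.flow.g j))) ∧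
      (Sect2.admB (F.P K) ν M g s₀.Ω s₀.Λ j (Sect2.domSites (F.P K) M j X) = true →
        Sect2.ofBackgroundC Sg.ι (U s₀ Wc) ∈ Sect2.spaceMS Sg (Rz s₀) M j (Sect2.domSites (F.P K) M j X) s₀.Ω))
    {t : SeqOfRecord F ν M g K k → Sect2.TermValues (F.P K) 𝔸 V M} {Ek : SeqOfRecord F ν M g K k → ℝ}
    (h : HasSect2FormAtZS F N V K Sg k Rz W U (fun s₀ t₀ => Sect2.LawsRT (sect2TowerOfRecord F N V K Sg (Rz s₀) s₀ t₀) Sg.lf k) slot t Ek) :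
    HasSect2FormAtZS F N V K Sg k Rz W U (fun s₀ t₀ => Sect2.LawsRT (sect2TowerOfRecord F N V K Sg (Rz s₀) s₀ t₀) Sg.lf k) slot
      (fun s₀ => spaceTruncR Sg n₀ (t s₀)) Ek := by
  refine ⟨universalE_spaceTruncR h.1 Sg n₀, fun s₀ => ⟨lawsRT_spaceTruncR Sg (Rz s₀) s₀.Ω (t s₀) hk (h.2 s₀).1, ?_⟩⟩
  by_cases hs : slot s₀ = 0
  · exact Or.inl hs
  rcases (h.2 s₀).2 with h0 | hae
  · exact Or.inl h0
  · refine Or.inr ?_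
    filter_upwards [hae, sect2Slot_spaceTruncR_ae_eq_fibre Sg (Rz s₀) (W s₀) hk s₀ (Reg s₀) (hζ s₀) (t s₀) (Ek s₀) (U s₀) (h.2 s₀).1 hg (h1 s₀)]
      with Vn hVn hfibre hχ
    rw [hVn hχ]
    exact (hfibre fun Wc hW hR hoff hfb => hbg s₀ hs Wc (by rw [hW]; exact hχ) hR hoff hfb).symm

end Slot

end Summit.QuantumFields.YangMills.Theorems.BalabanUVNodesN11SpaceTruncationFibre

end
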